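import Literature.MathematicalPhysics.QuantumFieldTheory.Balaban1983to89.NodeOKernel216R
import Literature.MathematicalPhysics.QuantumFieldTheory.Balaban1983to89.NodeOJetCalculus

/-!
# `Balaban1983to89.NodeOJetFamily` — THE JET FAMILY OF A TERM (every kernel entry replaced by its second-order Taylor polynomial at the
# base configuration), THE JET RECORD `Jet216R`, ITS CONSUMPTION BY THE (2.16)-LEVEL RECORD AT EVERY RADIUS, AND THE KERNEL-LEVEL JET
# AGREEMENT (T. Bałaban, CMP **116** (1988) [II] = [Balaban1988RG2Cluster] (2.14)–(2.16) pp. 15–16; CMP **109** (1987) [I] =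
# [Balaban1987RG1] (4.3)–(4.5) pp. 281–282, (1.22) p. 264)

statement-level skeleton of published theorems with citation tags; proofs where landed; nothing here is a claim about the Yang–Mills mass gap

CITATION HEADER (lean-in-tree rule).  Ideation cell `ym-nodeO-ideate` (portfolio track, 2026-08-25), seat P3 «weaken the target», memo
`memos/ROUTE-P3.md` v3.15 (sha256 756f0b72…) §2 row W-jet2, §9 nomination **N2** («the (2.16)-level consumption sockets»; the jet-family
declarations cut from N1 `NodeOJetCalculus` and promised there as N2).  LANDING EDITION (generation 14), module 3 of N2, of the memo companion
`memos/ROUTE-P3-SketchJet.lean` («JT», sha256 be2c53c0…, 794 l., 0 `sorry`, 0 `axiom`; referee REF g18 PASS 2026-08-25T17:49:30Z;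
director-ym LINE №2 (A)∕(B)): JT §2 :172–:219 (`kjet`, `kjet_G2_apply`, `kjet_A2_apply`, §2b `kjet_G2_zero`, `kjet_A2_zero`), §3 :236–:260
(**`Jet216R`**), §4 :262–:318 (**`Jet216R.kernel216R_kjet`**), §7 :550–:566 (`Jet216R.jet_agreement_G2`), §8 :607–:632 (`kjet_A2_isSymm`,
`Jet216R.jet_agreement_A2`), §8c :732–:780 (`entries`, **`Jet216R.objects_jet_agreement`**).  Statements and proofs below are
CHARACTER-IDENTICAL to JT's; edition deltas = the namespace (`YM.NodeO.P3.Jet` → this module's), this header, the imports (JT's three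
→ module 2 `NodeOKernel216R` + N1 `NodeOJetCalculus`, which carry JT's `B13TermWalkDataOneTorus` ∕ `HolomorphicBanach` chains; JT's
`Beta.RemainderStepAdapterHolo` import served only its docstrings' pointers), the opens cut to the ones used, the CUT of JT §1 ∕ §8a–b (now N1
`NodeOJetCalculus`: `jet2`, `norm_jet2_sub_le`, `differentiable_jet2`, `fderiv_jet2_zero`, `mixedDeriv_jet2`, `jet2_congr`,
`jet_transport_pi`, … reached by `open`), of JT §3's verbatim re-declaration `Kernel216R` :226 (module 2's, reached by `open`), of JT §5–§6
(module 4 `NodeOJetAcross`), the SECTIONING of the kernel-level theorems of JT §7 ∕ §8 ∕ §8c into one `section KernelAgreement` with JT's own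
`variable {E : Type*} [NormedAddCommGroup E] [NormedSpace ℂ E]` (their binders are explicit; nothing else was in scope for them), one-line
`[cite:]` docstrings ADDED to the two definitional `@[simp]` lemmas `kjet_G2_apply` ∕ `kjet_A2_apply` and to `entries` (JT had none ∕ an
untagged one), cite tags appended to the `[folklore]` docstrings, and the companion's closing `#print axioms` lines dropped.  LABELS in the
docstrings (memo-side words, NOT tree declarations): «NODE O» = :353 `B13TermWalkDataOneTorus.ExistsUniformAcrossSmall`; «NODE A» =
`B13PrimitiveKernels216.h226_torus_of_kernelBounds`; «NODE B», «D.3», «(D4) wall», «SM» ∕ «SketchZero» ∕ «TH» (other memo companions),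
«T21c» (module 2's source), «SK» (module 1's source), «the spine», «β-road», «(W-jet2)», «(W-216R)», «(J2)», «(J3)» = memo row ∕ price
labels, named only; «[II]» = [Balaban1988RG2Cluster]; «[I]» = [Balaban1987RG1]; «[B9]» = [Balaban1985BackgroundPropagators]; «[B7]», «[B8]»
= Bałaban's propagator papers CMP **95**, **96** (1984) as cited in [II] (letters only); [Chae1985] = S. B. Chae, Holomorphy and Calculus
in Normed Spaces (Dekker 1985).

PRINT STATUS (LIT `lit/SOURCES.md` §1.1 ∕ §6).  PRINTED: the kernels and their located bounds (2.14)–(2.16) pp. 15–16; the configuration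
dependence of the effective densities entering only through value ∕ first ∕ second derivatives at the base point, [I] (4.3)–(4.5)
pp. 281–282 with (1.22) p. 264 (the remainder step).  NOT PRINTED AS SUCH: the jet family `kjet` and the record `Jet216R` — a TYPED
REFORMULATION: Bałaban never truncates his kernels; the observation that the (D4)-wall read-outs see only the second-order jet is the content
of [I] §4's Taylor formula, packaged here as data + a record so that the tree's (2.16)-level consumers apply verbatim to the jet family.
Calculus: [Chae1985] Ch. 14 (via N1).  Proofs: [folklore] relative to N1 and modules 1–2.

WHAT IS PROVED (sorry-free, axiom-free).
* §2 `kjet 𝒦` (DATA) with `kjet_G2_apply` ∕ `kjet_A2_apply` (rfl) and the base-section identities `kjet_G2_zero` ∕ `kjet_A2_zero`.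
* §3 `Jet216R 𝒦 κ K_Γ K₀ θ⁰_Γ θ⁰_E K₁ K₂` (the jet record: two real reference localisations, σ-part of (2.16) at `u = 0`, located
  letters on the first and mixed second `u`-derivatives at `0`, a letter-free germ clause).
* §4 **`Jet216R.kernel216R_kjet`**: the jet record gives module 2's `Kernel216R (kjet 𝒦) α κ K_Γ K₀ (θ⁰_Γ + K₁α + ½K₂α²)
  (θ⁰_E + K₁α + ½K₂α²)` at EVERY radius `α` — hence, by name, `Kernel216R.toKernel216` → `Kernel216.localisation17a` ∕
  `differences216` (NODE A's inputs).
* §7–§8 `Jet216R.jet_agreement_G2` ∕ `jet_agreement_A2` (value, first derivative, mixed second derivatives of every entry of `kjet 𝒦` and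
  of `𝒦` agree at the base configuration); `kjet_A2_isSymm` (symmetry inherited); §8c `entries`, **`Jet216R.objects_jet_agreement`** (for
  every holomorphic `Φ` of the entries, `Φ ∘ entries 𝒦 σ` and `Φ ∘ entries (kjet 𝒦) σ` have the same second-order jet at `0` — N1
  `jet_transport_pi`).

WHAT THIS IS NOT.  NOT an inhabitant of :353, of `Jet216R`, of `Kernel216R` or of any socket; NOT the claim that Bałaban's local factors are
a holomorphic `Φ` of the kernel entries ((J2), objects-side) nor the (1.7)-factorisation of the jet objects ((J3)); NOT a change to NODE A;
nothing of Bałaban's `C^{(k)}(Z₀,σ,u)`, `Γ_k(Z₀,σ)` is constructed or asserted; no YM-PLAN ∕ Track-B node is claimed closed and no Track-B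
number is produced; not continuum, not mass gap, not Clay.  NEW file, imports built tree modules only; nothing modified.  Dimension-generic.
Net new unproved facts: 0.
[cite: Balaban1988RG2Cluster, (2.14)–(2.16) pp.15–16; Balaban1987RG1, (4.3)–(4.5) pp.281–282, (1.22) p.264; Chae1985, Thm 14.13] -/

noncomputable section

open Metric Set Filter
open scoped Topology

namespace Literature.MathematicalPhysics.QuantumFieldTheory.Balaban1983to89.NodeOJetFamily

open Literature.MathematicalPhysics.QuantumFieldTheory.Balaban1983to89.NodeOKernel216
open Literature.MathematicalPhysics.QuantumFieldTheory.Balaban1983to89.NodeOKernel216R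
open Literature.MathematicalPhysics.QuantumFieldTheory.Balaban1983to89.NodeOJetCalculus
open Literature.MathematicalPhysics.QuantumFieldTheory.Balaban1983to89.TreeLengthTorus (TPt)
open Literature.MathematicalPhysics.QuantumFieldTheory.Balaban1983to89.B5TorusCover (UT)
open Literature.MathematicalPhysics.QuantumFieldTheory.Balaban1983to89.B9Thm37GlueTorus (tdist1)
open Literature.MathematicalPhysics.QuantumFieldTheory.Balaban1983to89.B13JointWalkExpansion (JointWalkExpansion WalkMajorants)
open Literature.MathematicalPhysics.QuantumFieldTheory.Balaban1983to89.B13TermWalkData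
open Literature.MathematicalPhysics.QuantumFieldTheory.Balaban1983to89.B13TermWalkDataOneTorus (SmallTheta ExistsUniformAcrossSmall)
open Literature.MathematicalPhysics.QuantumFieldTheory.Balaban1983to89.B12Decay510 (mixedDeriv)
open Literature.MathematicalPhysics.QuantumFieldTheory.Balaban1983to89.B12Decay510Holo
open Literature.Analysis.Complex

/-! ## §2  The jet family of a term: every kernel entry replaced by its second-order Taylor polynomial at `u = 0` -/

section JetFamily

variable {c : B13.Consts} {d N' ν : ℕ} {Nf : Fin ν → ℕ} [∀ i, NeZero (Nf i)]
variable {E : Type*} [NormedAddCommGroup E] [NormedSpace ℂ E]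

/-- **THE JET FAMILY OF A TERM** (the «polynomial lift»): same rows, columns, locations, σ-region, fibre bound and REAL
reference data `Γ₀ = G(0,0)`, `C = A(0,0)⁻¹ ≻ 0`; the precision and the Γ-kernel replaced ENTRYWISE by their second-order
Taylor polynomials in the configuration at the base point, `u ↦ K(σ,0) + DK(σ,0)[u] + ½D²K(σ,0)[u,u]`.  The base section
`u = 0` is unchanged (§2b).  DATA; nothing asserted. [cite: Balaban1988RG2Cluster, (2.14)–(2.16) pp.15–16; Balaban1987RG1, (4.3) p.281] -/
def kjet (𝒦 : TermKernels c d N' ν Nf E) : TermKernels c d N' ν Nf E where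
  Λ := 𝒦.Λ
  C₀ := 𝒦.C₀
  A2 := fun σ v => Matrix.of fun b b' => jet2 (fun u => 𝒦.A2 σ u b b') v
  G2 := fun σ v => Matrix.of fun b j => jet2 (fun u => 𝒦.G2 σ u b j) v
  Γ₀ := 𝒦.Γ₀
  C := 𝒦.C
  locΛ := 𝒦.locΛ
  locN := 𝒦.locN
  X := 𝒦.X
  m := 𝒦.m
  hfib := 𝒦.hfib
  hG0 := by
    rw [← 𝒦.hG0]; ext b j; simp only [Matrix.of_apply, jet2_zero]
  hC0 := by
    have e : (Matrix.of fun b b' => jet2 (fun u => 𝒦.A2 0 u b b') (0 : E)) = 𝒦.A2 0 0 := by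
      ext b b'; simp only [Matrix.of_apply, jet2_zero]
    rw [e]; exact 𝒦.hC0
  hC := 𝒦.hC

/-- Entry formula of the jet family's Γ-kernel (definitional). [cite: Balaban1988RG2Cluster, (2.14)–(2.16) pp.15–16] -/
@[simp] theorem kjet_G2_apply (𝒦 : TermKernels c d N' ν Nf E) (σ : TPt d N' → ℂ) (v : E) (b : 𝒦.Λ) (j : 𝒦.Λ ⊕ 𝒦.C₀) :
    (kjet 𝒦).G2 σ v b j = jet2 (fun u => 𝒦.G2 σ u b j) v := rfl

/-- Entry formula of the jet family's precision (definitional). [cite: Balaban1988RG2Cluster, (2.14)–(2.16) pp.15–16] -/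
@[simp] theorem kjet_A2_apply (𝒦 : TermKernels c d N' ν Nf E) (σ : TPt d N' → ℂ) (v : E) (b b' : 𝒦.Λ) :
    (kjet 𝒦).A2 σ v b b' = jet2 (fun u => 𝒦.A2 σ u b b') v := rfl

/-! ### §2b  The base section is unchanged — the spine's zero-seam reading (SketchZero `kconst`) does not see the lift -/

/-- `(kjet 𝒦).G2 σ 0 = 𝒦.G2 σ 0`: the jet family and the family agree AT THE BASE CONFIGURATION for every `σ`; so
`kconst (kjet 𝒦) = kconst 𝒦` (SketchZero :84) and every base-point (run-member ∕ spine) reading is literally unchanged. [folklore]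
[cite: Balaban1988RG2Cluster, (2.14)–(2.16) pp.15–16] -/
@[simp] theorem kjet_G2_zero (𝒦 : TermKernels c d N' ν Nf E) (σ : TPt d N' → ℂ) : (kjet 𝒦).G2 σ 0 = 𝒦.G2 σ 0 := by
  ext b j; simp only [kjet_G2_apply, jet2_zero]

/-- `(kjet 𝒦).A2 σ 0 = 𝒦.A2 σ 0`. [folklore] [cite: Balaban1988RG2Cluster, (2.14)–(2.16) pp.15–16] -/
@[simp] theorem kjet_A2_zero (𝒦 : TermKernels c d N' ν Nf E) (σ : TPt d N' → ℂ) : (kjet 𝒦).A2 σ 0 = 𝒦.A2 σ 0 := by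
  ext b b'; simp only [kjet_A2_apply, jet2_zero]

/-! ## §3  THE JET RECORD (the (2.16)-level socket it meets is module 2's `NodeOKernel216R.Kernel216R`) -/

/-- (W-jet2, ONE TERM) **THE JET RECORD — NODE O's complex-background content reduced to the SECOND-ORDER GERM AT THE
BASE POINT**: the two real reference localisations (`Γ₀`, `C` — [B9] flat case ∕ [B7], [B8] letters); the σ-PART of (2.16)
AT THE BASE CONFIGURATION `u = 0` only (complex decoupling parameters on the polydisc, small `θ⁰_Γ, θ⁰_E` — the
`e^{−εR_σ}` mechanism, unchanged); LOCATED LETTERS `K₁`, `K₂` on the first `u`-derivative and on the mixed second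
`u`-derivative of every kernel entry AT `u = 0` (operator ∕ bilinear form bounds with the torus decay of the entry);
and the letter-free GERM clause (the entries are complex-differentiable on SOME ball around `u = 0` — what makes
`fderiv`∕`mixedDeriv` honest and carries the chain rule of the identification; no radius is a letter).  NO majorant on
any ball of configurations, no analyticity radius, no (2.16) at any `u ≠ 0`.
[cite: Balaban1988RG2Cluster, (2.16) p.16, p.15; Balaban1987RG1, (4.3)–(4.5) pp.281–282, (1.22) p.264] -/
structure Jet216R (𝒦 : TermKernels c d N' ν Nf E) (kap KΓ K₀ θΓ θE K₁ K₂ : ℝ) : Prop where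
  refΓ : ∀ b j, ‖𝒦.Γ₀ b j‖ ≤ KΓ * Real.exp (-(kap * tdist1 Nf (𝒦.locΛ b) (𝒦.locN j)))
  refC : ∀ b b', ‖𝒦.C b b'‖ ≤ K₀ * Real.exp (-(kap * tdist1 Nf (𝒦.locΛ b) (𝒦.locΛ b')))
  dΓ0 : ∀ σ : TPt d N' → ℂ, (∀ j, ‖σ j‖ ≤ Real.exp c.κ₁) →
    ∀ b j, ‖(𝒦.G2 σ 0 - 𝒦.Γ₀.map (algebraMap ℝ ℂ)) b j‖ ≤ θΓ * Real.exp (-(kap * tdist1 Nf (𝒦.locΛ b) (𝒦.locN j)))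
  dE0 : ∀ σ : TPt d N' → ℂ, (∀ j, ‖σ j‖ ≤ Real.exp c.κ₁) →
    ∀ b b', ‖(𝒦.A2 σ 0 - 𝒦.C⁻¹.map (algebraMap ℝ ℂ)) b b'‖ ≤ θE * Real.exp (-(kap * tdist1 Nf (𝒦.locΛ b) (𝒦.locΛ b')))
  germ : ∃ ρ : ℝ, 0 < ρ ∧ JointWalkExpansion.AnalyticOnBall c 𝒦.A2 ρ ∧ JointWalkExpansion.AnalyticOnBall c 𝒦.G2 ρ
  d1Γ : ∀ σ : TPt d N' → ℂ, (∀ j, ‖σ j‖ ≤ Real.exp c.κ₁) → ∀ b j (v : E),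
    ‖fderiv ℂ (fun u => 𝒦.G2 σ u b j) 0 v‖ ≤ K₁ * Real.exp (-(kap * tdist1 Nf (𝒦.locΛ b) (𝒦.locN j))) * ‖v‖
  d2Γ : ∀ σ : TPt d N' → ℂ, (∀ j, ‖σ j‖ ≤ Real.exp c.κ₁) → ∀ b j (v w : E),
    ‖mixedDeriv (fun u => 𝒦.G2 σ u b j) v w‖ ≤ K₂ * Real.exp (-(kap * tdist1 Nf (𝒦.locΛ b) (𝒦.locN j))) * ‖v‖ * ‖w‖
  d1E : ∀ σ : TPt d N' → ℂ, (∀ j, ‖σ j‖ ≤ Real.exp c.κ₁) → ∀ b b' (v : E),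
    ‖fderiv ℂ (fun u => 𝒦.A2 σ u b b') 0 v‖ ≤ K₁ * Real.exp (-(kap * tdist1 Nf (𝒦.locΛ b) (𝒦.locΛ b'))) * ‖v‖
  d2E : ∀ σ : TPt d N' → ℂ, (∀ j, ‖σ j‖ ≤ Real.exp c.κ₁) → ∀ b b' (v w : E),
    ‖mixedDeriv (fun u => 𝒦.A2 σ u b b') v w‖ ≤ K₂ * Real.exp (-(kap * tdist1 Nf (𝒦.locΛ b) (𝒦.locΛ b'))) * ‖v‖ * ‖w‖

/-! ## §4  CONSUMPTION: the jet record feeds the (2.16)-level socket AT EVERY RADIUS through the jet family -/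

namespace Jet216R

variable {𝒦 : TermKernels c d N' ν Nf E} {kap KΓ K₀ θΓ θE K₁ K₂ : ℝ}

/-- **(W-jet2) ⟹ (W-216R) FOR THE JET FAMILY, ANY RADIUS `α ≥ 0`**, letters `(κ, K_Γ, K₀, θ⁰_Γ + K₁α + ½K₂α²,
θ⁰_E + K₁α + ½K₂α²)`: the located differences of the jet family at `(σ, v)` split as (jet excursion, §1
`norm_jet2_sub_le`) + (σ-part at the base configuration); its entries are ENTIRE in `v` (§1 `differentiable_jet2`), so the
holomorphy fields hold on every ball.  Downstream BY NAME: T21c `Kernel216R.toKernel216` :348 (Neumann, NODE A's regime) →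
SK `Kernel216.localisation17a` ∕ `differences216` :2576 ∕ :2595 = NODE A's `h17 h16` + `haE haΓ` at every `‖v‖ ≤ α`.
[cite: Balaban1988RG2Cluster, (2.16) p.16, p.15; Balaban1987RG1, (4.3)–(4.4) p.281] -/
theorem kernel216R_kjet (h : Jet216R 𝒦 kap KΓ K₀ θΓ θE K₁ K₂) (hK₁ : 0 ≤ K₁) (hK₂ : 0 ≤ K₂) (α : ℝ) :
    Kernel216R (kjet 𝒦) α kap KΓ K₀ (θΓ + (K₁ * α + 1 / 2 * K₂ * α ^ 2)) (θE + (K₁ * α + 1 / 2 * K₂ * α ^ 2)) := by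
  obtain ⟨ρ, hρ, hgermE, hgermΓ⟩ := h.germ
  refine ⟨h.refΓ, h.refC, fun σ hσ v hv b j => ?_, fun σ hσ v hv b b' => ?_, fun σ hσ b b' => ?_, fun σ hσ b j => ?_⟩
  · -- Γ-difference of the jet family at (σ, v)
    set g : ℝ := Real.exp (-(kap * tdist1 Nf (𝒦.locΛ b) (𝒦.locN j))) with hg
    have hg0 : 0 ≤ g := (Real.exp_pos _).le
    have hjet : ‖jet2 (fun u => 𝒦.G2 σ u b j) v - 𝒦.G2 σ 0 b j‖ ≤ K₁ * g * ‖v‖ + 1 / 2 * (K₂ * g) * ‖v‖ ^ 2 :=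
      norm_jet2_sub_le (f := fun u => 𝒦.G2 σ u b j) (fun v => h.d1Γ σ hσ b j v)
        (fun v w => by have := h.d2Γ σ hσ b j v w; rw [hg]; linarith [this]) v
    have hσpart := h.dΓ0 σ hσ b j
    rw [Matrix.sub_apply] at hσpart ⊢
    rw [kjet_G2_apply]
    calc ‖jet2 (fun u => 𝒦.G2 σ u b j) v - (kjet 𝒦).Γ₀.map (algebraMap ℝ ℂ) b j‖
        = ‖(jet2 (fun u => 𝒦.G2 σ u b j) v - 𝒦.G2 σ 0 b j) + (𝒦.G2 σ 0 b j - 𝒦.Γ₀.map (algebraMap ℝ ℂ) b j)‖ := by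
          rw [sub_add_sub_cancel]; rfl
      _ ≤ ‖jet2 (fun u => 𝒦.G2 σ u b j) v - 𝒦.G2 σ 0 b j‖ + ‖𝒦.G2 σ 0 b j - 𝒦.Γ₀.map (algebraMap ℝ ℂ) b j‖ :=
          norm_add_le _ _
      _ ≤ (K₁ * α + 1 / 2 * K₂ * α ^ 2) * g + θΓ * g :=
          add_le_add (hjet.trans (jet_budget_le hK₁ hK₂ hg0 hv)) hσpart
      _ = (θΓ + (K₁ * α + 1 / 2 * K₂ * α ^ 2)) * g := by ring
  · -- precision difference of the jet family at (σ, v)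
    set g : ℝ := Real.exp (-(kap * tdist1 Nf (𝒦.locΛ b) (𝒦.locΛ b'))) with hg
    have hg0 : 0 ≤ g := (Real.exp_pos _).le
    have hjet : ‖jet2 (fun u => 𝒦.A2 σ u b b') v - 𝒦.A2 σ 0 b b'‖ ≤ K₁ * g * ‖v‖ + 1 / 2 * (K₂ * g) * ‖v‖ ^ 2 :=
      norm_jet2_sub_le (f := fun u => 𝒦.A2 σ u b b') (fun v => h.d1E σ hσ b b' v)
        (fun v w => by have := h.d2E σ hσ b b' v w; rw [hg]; linarith [this]) v
    have hσpart := h.dE0 σ hσ b b'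
    rw [Matrix.sub_apply] at hσpart ⊢
    rw [kjet_A2_apply]
    calc ‖jet2 (fun u => 𝒦.A2 σ u b b') v - (kjet 𝒦).C⁻¹.map (algebraMap ℝ ℂ) b b'‖
        = ‖(jet2 (fun u => 𝒦.A2 σ u b b') v - 𝒦.A2 σ 0 b b') + (𝒦.A2 σ 0 b b' - 𝒦.C⁻¹.map (algebraMap ℝ ℂ) b b')‖ := by
          rw [sub_add_sub_cancel]; rfl
      _ ≤ ‖jet2 (fun u => 𝒦.A2 σ u b b') v - 𝒦.A2 σ 0 b b'‖ + ‖𝒦.A2 σ 0 b b' - 𝒦.C⁻¹.map (algebraMap ℝ ℂ) b b'‖ :=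
          norm_add_le _ _
      _ ≤ (K₁ * α + 1 / 2 * K₂ * α ^ 2) * g + θE * g :=
          add_le_add (hjet.trans (jet_budget_le hK₁ hK₂ hg0 hv)) hσpart
      _ = (θE + (K₁ * α + 1 / 2 * K₂ * α ^ 2)) * g := by ring
  · -- holomorphy of the precision entries of the jet family: ENTIRE
    exact (differentiable_jet2 hρ (hgermE σ hσ b b') (K₂ := K₂ * Real.exp (-(kap * tdist1 Nf (𝒦.locΛ b) (𝒦.locΛ b'))))
      (fun v w => by have := h.d2E σ hσ b b' v w; linarith [this])).differentiableOn
  · exact (differentiable_jet2 hρ (hgermΓ σ hσ b j) (K₂ := K₂ * Real.exp (-(kap * tdist1 Nf (𝒦.locΛ b) (𝒦.locN j))))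
      (fun v w => by have := h.d2Γ σ hσ b j v w; linarith [this])).differentiableOn

end Jet216R

end JetFamily

/-! ## §7–§8  KERNEL-LEVEL JET AGREEMENT (value, first derivative, mixed second derivatives at the base configuration) and the
objects-level corollary through N1 `NodeOJetCalculus.jet_transport_pi` -/

section KernelAgreement

variable {E : Type*} [NormedAddCommGroup E] [NormedSpace ℂ E]

/-- **JET AGREEMENT FOR THE JET FAMILY** (every term with a germ clause and a second-derivative letter, e.g. under
`Jet216R`): for every `σ` in the polydisc, every Γ-entry of `kjet 𝒦` has at the base configuration the same value, the
same first `u`-derivative and the same mixed second `u`-derivatives as the entry of `𝒦`.  With §2b this is the typed half of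
the identification transport of memo §2 row W-jet2; the other half — the chain rule through (2.13) and NODE B's functional
on each finite torus — is OBJECTS-side. [folklore]
[cite: Balaban1987RG1, (4.3)–(4.5) pp.281–282; Balaban1988RG2Cluster, (2.16) p.16; Chae1985, Thm 14.13] -/
theorem Jet216R.jet_agreement_G2 {c : B13.Consts} {d N' ν : ℕ} {Nf : Fin ν → ℕ} [∀ i, NeZero (Nf i)]
    {𝒦 : TermKernels c d N' ν Nf E} {kap KΓ K₀ θΓ θE K₁ K₂ : ℝ} (h : Jet216R 𝒦 kap KΓ K₀ θΓ θE K₁ K₂)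
    (σ : TreeLengthTorus.TPt d N' → ℂ) (hσ : ∀ j, ‖σ j‖ ≤ Real.exp c.κ₁) (b : 𝒦.Λ) (j : 𝒦.Λ ⊕ 𝒦.C₀) :
    (kjet 𝒦).G2 σ 0 b j = 𝒦.G2 σ 0 b j ∧
    fderiv ℂ (fun u => (kjet 𝒦).G2 σ u b j) 0 = fderiv ℂ (fun u => 𝒦.G2 σ u b j) 0 ∧
    ∀ v w : E, mixedDeriv (fun u => (kjet 𝒦).G2 σ u b j) v w = mixedDeriv (fun u => 𝒦.G2 σ u b j) v w := by
  obtain ⟨ρ, hρ, -, hgermΓ⟩ := h.germ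
  have h2 : ∀ v w : E, ‖mixedDeriv (fun u => 𝒦.G2 σ u b j) v w‖
      ≤ K₂ * Real.exp (-(kap * tdist1 Nf (𝒦.locΛ b) (𝒦.locN j))) * ‖v‖ * ‖w‖ := fun v w => h.d2Γ σ hσ b j v w
  refine ⟨by rw [kjet_G2_zero], ?_, fun v w => ?_⟩
  · exact fderiv_jet2_zero hρ (hgermΓ σ hσ b j) h2
  · exact mixedDeriv_jet2 hρ (hgermΓ σ hσ b j) h2 v w

/-- **SYMMETRY IS INHERITED BY THE JET FAMILY** (NODE A's per-configuration binder `hAs`,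
`B13PrimitiveKernels216.h226_torus_of_kernelBounds`): if the precision `u ↦ A(σ,u)` is a symmetric matrix for every `u`
near the base point, so is `(kjet 𝒦).A2 σ v` for EVERY `v` (entrywise jets of equal germs). [folklore]
[cite: Balaban1988RG2Cluster, (2.14)–(2.16) pp.15–16] -/
theorem kjet_A2_isSymm {c : B13.Consts} {d N' ν : ℕ} {Nf : Fin ν → ℕ} [∀ i, NeZero (Nf i)]
    (𝒦 : TermKernels c d N' ν Nf E) (σ : TreeLengthTorus.TPt d N' → ℂ) {ρ : ℝ} (hρ : 0 < ρ)
    (hs : ∀ u ∈ ball (0 : E) ρ, (𝒦.A2 σ u).IsSymm) (v : E) : ((kjet 𝒦).A2 σ v).IsSymm := by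
  refine Matrix.IsSymm.ext fun b b' => ?_
  have hev : (fun u => 𝒦.A2 σ u b' b) =ᶠ[𝓝 0] (fun u => 𝒦.A2 σ u b b') := by
    filter_upwards [isOpen_ball.mem_nhds (mem_ball_self hρ)] with u hu
    exact (hs u hu).apply b b'
  simp only [kjet_A2_apply]
  exact congrFun (jet2_congr hev) v

/-- **JET AGREEMENT FOR THE PRECISION** (companion of §7 `jet_agreement_G2`). [folklore]
[cite: Balaban1987RG1, (4.3)–(4.5) pp.281–282; Balaban1988RG2Cluster, (2.16) p.16; Chae1985, Thm 14.13] -/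
theorem Jet216R.jet_agreement_A2 {c : B13.Consts} {d N' ν : ℕ} {Nf : Fin ν → ℕ} [∀ i, NeZero (Nf i)]
    {𝒦 : TermKernels c d N' ν Nf E} {kap KΓ K₀ θΓ θE K₁ K₂ : ℝ} (h : Jet216R 𝒦 kap KΓ K₀ θΓ θE K₁ K₂)
    (σ : TreeLengthTorus.TPt d N' → ℂ) (hσ : ∀ j, ‖σ j‖ ≤ Real.exp c.κ₁) (b b' : 𝒦.Λ) :
    (kjet 𝒦).A2 σ 0 b b' = 𝒦.A2 σ 0 b b' ∧
    fderiv ℂ (fun u => (kjet 𝒦).A2 σ u b b') 0 = fderiv ℂ (fun u => 𝒦.A2 σ u b b') 0 ∧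
    ∀ v w : E, mixedDeriv (fun u => (kjet 𝒦).A2 σ u b b') v w = mixedDeriv (fun u => 𝒦.A2 σ u b b') v w := by
  obtain ⟨ρ, hρ, hgermE, -⟩ := h.germ
  have h2 : ∀ v w : E, ‖mixedDeriv (fun u => 𝒦.A2 σ u b b') v w‖
      ≤ K₂ * Real.exp (-(kap * tdist1 Nf (𝒦.locΛ b) (𝒦.locΛ b'))) * ‖v‖ * ‖w‖ := fun v w => h.d2E σ hσ b b' v w
  refine ⟨by rw [kjet_A2_zero], ?_, fun v w => ?_⟩
  · exact fderiv_jet2_zero hρ (hgermE σ hσ b b') h2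
  · exact mixedDeriv_jet2 hρ (hgermE σ hσ b b') h2 v w

/-! ### §8c  The kernel-level corollary: objects built holomorphically on the entries of the jet family -/

/-- The entries of a term's kernels at fixed `σ`, as one point of `ℂ^ι`, `ι = (Λ × (Λ ⊕ C₀)) ⊕ (Λ × Λ)` (`C₀` finite as
in NODE A). DATA. [cite: Balaban1988RG2Cluster, (2.14)–(2.16) pp.15–16] -/
def entries {c : B13.Consts} {d N' ν : ℕ} {Nf : Fin ν → ℕ} [∀ i, NeZero (Nf i)] (𝒦 : TermKernels c d N' ν Nf E)
    (σ : TreeLengthTorus.TPt d N' → ℂ) (u : E) : (𝒦.Λ × (𝒦.Λ ⊕ 𝒦.C₀)) ⊕ (𝒦.Λ × 𝒦.Λ) → ℂ :=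
  Sum.elim (fun p => 𝒦.G2 σ u p.1 p.2) (fun p => 𝒦.A2 σ u p.1 p.2)

/-- **OBJECTS-LEVEL JET AGREEMENT** (the typed part of price (J2)): under the jet record (germ + second-derivative letters),
for every `σ` in the polydisc and EVERY holomorphic function `Φ` of the kernel entries (defined on an open set met by both
germs), the object built on the jet family `kjet 𝒦` and the object built on `𝒦` have the same value, the same first
`u`-derivative and the same mixed second `u`-derivatives at the base configuration — the three read-outs of the (D4) wall.
What is NOT typed: that Bałaban's local factors are such a `Φ` ((2.13)–(2.14) + Lemma 3's finite term sum, on each finite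
torus), and (J3) the (1.7)-factorisation of the jet objects. [folklore]
[cite: Balaban1987RG1, (4.3)–(4.5) pp.281–282; Balaban1988RG2Cluster, (2.16) p.16; Chae1985, Thm 14.13] -/
theorem Jet216R.objects_jet_agreement {c : B13.Consts} {d N' ν : ℕ} {Nf : Fin ν → ℕ} [∀ i, NeZero (Nf i)]
    {𝒦 : TermKernels c d N' ν Nf E} [Fintype 𝒦.C₀] {kap KΓ K₀ θΓ θE K₁ K₂ : ℝ}
    (h : Jet216R 𝒦 kap KΓ K₀ θΓ θE K₁ K₂) {ρ : ℝ} (hρ : 0 < ρ)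
    (haE : JointWalkExpansion.AnalyticOnBall c 𝒦.A2 ρ) (haΓ : JointWalkExpansion.AnalyticOnBall c 𝒦.G2 ρ)
    (σ : TreeLengthTorus.TPt d N' → ℂ) (hσ : ∀ j, ‖σ j‖ ≤ Real.exp c.κ₁)
    {Φ : ((𝒦.Λ × (𝒦.Λ ⊕ 𝒦.C₀)) ⊕ (𝒦.Λ × 𝒦.Λ) → ℂ) → ℂ} {U : Set ((𝒦.Λ × (𝒦.Λ ⊕ 𝒦.C₀)) ⊕ (𝒦.Λ × 𝒦.Λ) → ℂ)}
    (hU : IsOpen U) (hΦ : DifferentiableOn ℂ Φ U)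
    (hkU : MapsTo (entries 𝒦 σ) (ball 0 ρ) U) (hk'U : MapsTo (entries (kjet 𝒦) σ) (ball 0 ρ) U) :
    (Φ ∘ entries 𝒦 σ) 0 = (Φ ∘ entries (kjet 𝒦) σ) 0 ∧
    fderiv ℂ (Φ ∘ entries 𝒦 σ) 0 = fderiv ℂ (Φ ∘ entries (kjet 𝒦) σ) 0 ∧
    ∀ v w : E, mixedDeriv (Φ ∘ entries 𝒦 σ) v w = mixedDeriv (Φ ∘ entries (kjet 𝒦) σ) v w := by
  -- entrywise differentiability of the two germs on the ball
  have hk : ∀ i, DifferentiableOn ℂ (fun u => entries 𝒦 σ u i) (ball 0 ρ) := by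
    rintro (⟨b, j⟩ | ⟨b, b'⟩)
    · exact haΓ σ hσ b j
    · exact haE σ hσ b b'
  have hk' : ∀ i, DifferentiableOn ℂ (fun u => entries (kjet 𝒦) σ u i) (ball 0 ρ) := by
    rintro (⟨b, j⟩ | ⟨b, b'⟩)
    · exact ((differentiable_jet2 hρ (haΓ σ hσ b j) (fun v w => h.d2Γ σ hσ b j v w)).differentiableOn :
        DifferentiableOn ℂ (jet2 fun u => 𝒦.G2 σ u b j) (ball 0 ρ))
    · exact ((differentiable_jet2 hρ (haE σ hσ b b') (fun v w => h.d2E σ hσ b b' v w)).differentiableOn :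
        DifferentiableOn ℂ (jet2 fun u => 𝒦.A2 σ u b b') (ball 0 ρ))
  -- kernel-level jet agreement (§2b + §7 + `jet_agreement_A2`)
  have aΓ := fun b j => h.jet_agreement_G2 σ hσ b j
  have aE := fun b b' => h.jet_agreement_A2 σ hσ b b'
  refine jet_transport_pi hU hΦ hρ hk hk' hkU hk'U ?_ ?_ ?_
  · rintro (⟨b, j⟩ | ⟨b, b'⟩)
    · exact ((aΓ b j).1).symm
    · exact ((aE b b').1).symm
  · rintro (⟨b, j⟩ | ⟨b, b'⟩)
    · exact ((aΓ b j).2.1).symm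
    · exact ((aE b b').2.1).symm
  · rintro (⟨b, j⟩ | ⟨b, b'⟩) v w
    · exact ((aΓ b j).2.2 v w).symm
    · exact ((aE b b').2.2 v w).symm

end KernelAgreement

end Literature.MathematicalPhysics.QuantumFieldTheory.Balaban1983to89.NodeOJetFamily

end
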